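import Literature.NumberTheory.Weil1964.ArchMetaplecticNormality
import Literature.RepresentationTheory.KonnoKonno2007.JunctionHyperbolicVacuumPin
import HarnessLib

/-!
# The metaplectic double cover over the Siegel Levi `GL(n, ℝ) ⊂ Sp(2n, ℝ)`: `levi a d` is normalised iff `det a > 0`

Topic `NumberTheory/Weil1964`; namespace `Literature.NumberTheory.Weil1964`.  Continuation of
`Literature.NumberTheory.Weil1964.ArchMetaplecticNormality` (unit scalars, Schur in group form, and — given the
record R1 `Folland1989_Thm_4_37_ab` — `‖C(y)‖² ‖det P(proj y)‖ = 1` for every implementer `y ∈ Mp^𝓢(W)`) and of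
`Literature.NumberTheory.Weil1964.ArchMetaplecticDoubleCover` (`P(m(a, d)) = ½(a + d)`, `follandP_leviSp`; the
geometric Levi implementers `MpS.levi a d : f ↦ |det a|^{-1/2} f(a⁻¹ x)`, Folland (4.24)).  The one analytic input is
the POSITIVITY of the Gaussian integral `⟪h₀, |det a|^{-1/2} h₀ ∘ a⁻¹⟫ > 0` — the tree's
`Literature.RepresentationTheory.KonnoKonno2007.exists_vacCoeffS_leviS_eq` (`JunctionHyperbolicVacuumPin`); NO Gaussian
integral is evaluated here.

* §3a the block: from `a x · d y = x · y` the matrices satisfy `ᵗA D = 1` (`d = ᵗa⁻¹`), and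
  **`det P(m(a, d)) = r · det a` with `r > 0`** (`Sp.exists_pos_det_follandP_leviSp`: `ᵗa (a + ᵗa⁻¹) = 1 + ᵗa a ≻ 0`,
  `det P = 2^{-n} det(1 + ᵗa a)/det a`) — `det P(m(a,d))` is real with the sign of `det a`;
* §3b the fibre: a metaplectic `levi a d` forces `det a > 0` (`det_pos_of_isMetaplectic_levi`, unconditional);
  GIVEN R1, **`levi a d` is metaplectic iff `det a > 0`** (`isMetaplectic_levi_iff`: `levi a d = c · x` with `x`
  normalised and `|c| = 1`, and `c² = v² r det a` is a positive real of norm one); more generally `c · levi a d` is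
  metaplectic iff `c² · sign(det a) = 1` (`isMetaplectic_unitScalar_mul_levi_iff`): over `det a < 0` the metaplectic
  elements are `± i · levi a d`;
* §3c the section: `levi` is multiplicative (`levi_mul`, `levi_one`); the Levi pairs `leviPairs σ = {(a, d) :
  a x · d y = x · y}` and the positive Levi `leviPairsPos σ` (`det a > 0`) are subgroups of `GL(ℝ^σ) × GL(ℝ^σ)`;
  `leviHom : leviPairs σ →* Mp^𝓢(W)` and `leviHomPos : leviPairsPos σ →* Mp^𝓢(W)`; and **given R1 the metaplectic
  double cover SPLITS over the positive Siegel Levi `GL⁺(n, ℝ)` by the geometric section** (`isMetaplectic_leviHomPos`)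
  — the Levi part of Folland's normalised cocycle is trivial on the identity component, the real-place case of the
  standard fact that the metaplectic cover splits over the Siegel Levi up to a character of `det a`
  [Kudla1994, §§1–3: Rao's cocycle restricted to `P = MN`]; here DERIVED from R1 and Schur's lemma.

Use (pub-hodgecm2 literature fan-out, row B08-2 (b) [Paul1998, (1.2.1)]): in the dual pair `(U(V), U(W))`, on a
hyperbolic plane `H ⊂ W` the embedding `ι_V(g) = g ⊕ ḡ` on `V ⊗ H ≅ V ⊕ V̄` lies in a conjugate of the positive Siegel
Levi (`det_ℝ g = |det_ℂ g|² > 0`), so by §3c and `IsMetaplectic.conj_of` the cover splits there canonically.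

Everything here is PROVED (kernel); R1 enters only as an explicit hypothesis; citations record provenance only.

## References

* [Folland1989] G. B. Folland, *Harmonic Analysis in Phase Space*, Princeton UP 1989: §4.1 (4.4), (4.11); §4.2 (4.24),
  (4.36), Thm. (4.37); §1.7 (1.72).
* [Kudla1994] S. Kudla, *Splitting metaplectic covers of dual reductive pairs*, Israel J. Math. 87 (1994) 361–401,
  §§1–3.
* [Paul1998] A. Paul, *Howe correspondence for real unitary groups*, J. Funct. Anal. 159 (1998) 384–431, §1.2 (1.2.1).
-/

set_option autoImplicit false

noncomputable section

open MeasureTheory Complex SchwartzMap Matrix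
open scoped InnerProductSpace ComplexConjugate Real

namespace Literature.NumberTheory.Weil1964

open Literature.Analysis.SegalBargmann Literature.RepresentationTheory.HeisenbergGroup

variable {σ : Type*} [Fintype σ] [DecidableEq σ]

local notation "L2R" σ => Lp ℂ 2 (volume : Measure (σ → ℝ))
local notation "SR" σ => SchwartzMap (σ → ℝ) ℂ
local notation "PV" σ => (σ → ℝ) × (σ → ℝ)
local notation "SpR" σ => symplecticGroup (polar (dotPairing σ))

/-! ## 3a. The block `P(m(a, d))` -/

namespace Sp

/-- From `a x · d y = x · y`: the matrices satisfy `ᵗA D = 1`, i.e. `d = ᵗa⁻¹`. [cite: Folland1989, §4.1 (4.4), §4.2 (4.24)] -/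
theorem transpose_toMatrix_mul_toMatrix_eq_one (a d : (σ → ℝ) ≃ₗ[ℝ] (σ → ℝ))
    (had : ∀ x y, dotPairing σ (a x) (d y) = dotPairing σ x y) :
    (LinearMap.toMatrix' (a : (σ → ℝ) →ₗ[ℝ] (σ → ℝ)))ᵀ * LinearMap.toMatrix' (d : (σ → ℝ) →ₗ[ℝ] (σ → ℝ)) = 1 := by
  ext i j
  have h := had (Pi.single i 1) (Pi.single j 1)
  rw [dotPairing_apply, dotPairing_apply, single_dotProduct, one_mul, Pi.single_apply] at h
  rw [Matrix.mul_apply, Matrix.one_apply, ← h, dotProduct]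
  refine Finset.sum_congr rfl fun k _ => ?_
  rw [Matrix.transpose_apply, LinearMap.toMatrix'_apply, LinearMap.toMatrix'_apply]
  rfl

/-- **`det P(m(a, d)) = r · det a` with `r > 0`**: `P(m(a,d)) = ½(a + ᵗa⁻¹)` and `ᵗa (a + ᵗa⁻¹) = ᵗa a + 1 ≻ 0`, so
`det P = 2^{-n} det(1 + ᵗa a) / det a`; in particular `det P(m(a,d))` is REAL with the SIGN OF `det a`.
[cite: Folland1989, §4.1 (4.11), §4.2 (4.24)] -/
theorem exists_pos_det_follandP_leviSp (a d : (σ → ℝ) ≃ₗ[ℝ] (σ → ℝ))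
    (had : ∀ x y, dotPairing σ (a x) (d y) = dotPairing σ x y) :
    ∃ r : ℝ, 0 < r ∧ (follandP (leviSp (dotPairing σ) a d had)).det =
      ((r * LinearMap.det (a : (σ → ℝ) →ₗ[ℝ] (σ → ℝ)) : ℝ) : ℂ) := by
  set A := LinearMap.toMatrix' (a : (σ → ℝ) →ₗ[ℝ] (σ → ℝ)) with hA
  set D := LinearMap.toMatrix' (d : (σ → ℝ) →ₗ[ℝ] (σ → ℝ)) with hD
  have hAD : Aᵀ * D = 1 := transpose_toMatrix_mul_toMatrix_eq_one a d had
  have hdetA : A.det = LinearMap.det (a : (σ → ℝ) →ₗ[ℝ] (σ → ℝ)) := LinearMap.det_toMatrix' _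
  have hA0 : A.det ≠ 0 := by rw [hdetA]; exact (LinearEquiv.isUnit_det' a).ne_zero
  have hPD : (1 + Aᵀ * A).PosDef := by
    have h := Matrix.posSemidef_conjTranspose_mul_self A
    rw [Matrix.conjTranspose_eq_transpose_of_trivial] at h
    exact Matrix.PosDef.one.add_posSemidef h
  have hpos : 0 < (1 + Aᵀ * A).det := hPD.det_pos
  have hprod : A.det * (A + D).det = (1 + Aᵀ * A).det := by
    rw [← Matrix.det_transpose A, ← Matrix.det_mul, Matrix.mul_add, hAD, add_comm]
  have hP : follandP (leviSp (dotPairing σ) a d had) = (2 : ℂ)⁻¹ • Complex.ofRealHom.mapMatrix (A + D) := by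
    rw [follandP_leviSp, map_add]
  refine ⟨(2 : ℝ)⁻¹ ^ Fintype.card σ * (1 + Aᵀ * A).det / A.det ^ 2,
    div_pos (mul_pos (pow_pos (by norm_num) _) hpos) (sq_pos_iff.2 hA0), ?_⟩
  rw [hP, Matrix.det_smul, ← RingHom.map_det, ← hdetA]
  have hAD' : (A + D).det = (1 + Aᵀ * A).det / A.det := by
    rw [← hprod, mul_div_cancel_left₀ _ hA0]
  rw [hAD', Complex.ofRealHom_eq_coe]
  push_cast
  field_simp

end Sp

namespace MpS

/-- **The vacuum coefficient of a Levi implementer is a positive real** (`⟪h₀, |det a|^{-1/2} h₀ ∘ a⁻¹⟫ > 0`, the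
tree's `exists_vacCoeffS_leviS_eq`). [cite: Folland1989, §4.2 (4.24), §1.7 (1.72)] -/
theorem exists_pos_vac_levi (a d : (σ → ℝ) ≃ₗ[ℝ] (σ → ℝ)) (had : ∀ x y, dotPairing σ (a x) (d y) = dotPairing σ x y) :
    ∃ v : ℝ, 0 < v ∧ vac (levi a d had) = v :=
  Literature.RepresentationTheory.KonnoKonno2007.exists_vacCoeffS_leviS_eq a

/-- **A metaplectic Levi implementer has `det a > 0`** (unconditional: `C(levi)² det P = v² r det a = 1` with
`v, r > 0`). [cite: Folland1989, §4.2 (4.24), Thm. (4.37)] -/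
theorem det_pos_of_isMetaplectic_levi {a d : (σ → ℝ) ≃ₗ[ℝ] (σ → ℝ)}
    {had : ∀ x y, dotPairing σ (a x) (d y) = dotPairing σ x y} (h : IsMetaplectic (levi a d had)) :
    0 < LinearMap.det (a : (σ → ℝ) →ₗ[ℝ] (σ → ℝ)) := by
  obtain ⟨v, hv, hvac⟩ := exists_pos_vac_levi a d had
  obtain ⟨r, hr, hdet⟩ := Sp.exists_pos_det_follandP_leviSp a d had
  have key : vac (levi a d had) ^ 2 * (Sp.follandP (proj (levi a d had))).det = 1 := h
  rw [proj_levi, hvac, hdet, ← Complex.ofReal_pow, ← Complex.ofReal_mul, Complex.ofReal_eq_one, ← mul_assoc] at key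
  have hvr : 0 < v ^ 2 * r := by positivity
  refine lt_of_not_ge fun hle => ?_
  have h2 := mul_nonpos_iff.2 (Or.inl ⟨hvr.le, hle⟩)
  rw [key] at h2
  exact absurd h2 (not_le.2 one_pos)

/-- **Given R1, `levi a d` is metaplectic iff `det a > 0`.**  (`levi a d = c · x` with `x` normalised, `|c| = 1`;
then `c² = v² r det a` is a positive real of norm one, i.e. `1`.) So Folland's normalisation holds ON THE NOSE for the
geometric Levi operators `|det a|^{-1/2} f(a⁻¹ x)` with `det a > 0`. [cite: Folland1989, §4.2 (4.24), Thm. (4.37)] -/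
theorem isMetaplectic_levi_iff (h1 : Folland1989_Thm_4_37_ab σ) (a d : (σ → ℝ) ≃ₗ[ℝ] (σ → ℝ))
    (had : ∀ x y, dotPairing σ (a x) (d y) = dotPairing σ x y) :
    IsMetaplectic (levi a d had) ↔ 0 < LinearMap.det (a : (σ → ℝ) →ₗ[ℝ] (σ → ℝ)) := by
  refine ⟨det_pos_of_isMetaplectic_levi, fun hdetpos => ?_⟩
  obtain ⟨x, hx, hxm⟩ := h1 (proj (levi a d had))
  obtain ⟨c, hc, hcx⟩ := exists_eq_unitScalar_mul_of_proj_eq (x := x) (y := levi a d had) hx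
  obtain ⟨v, hv, hvac⟩ := exists_pos_vac_levi a d had
  obtain ⟨r, hr, hdet⟩ := Sp.exists_pos_det_follandP_leviSp a d had
  have hxm' : vac x ^ 2 * (Sp.follandP (leviSp (dotPairing σ) a d had)).det = 1 := by
    have h := hxm
    rwa [isMetaplectic_iff, hx, proj_levi] at h
  have hvc : (v : ℂ) = c * vac x := by rw [← hvac, hcx, vac_unitScalar_mul]
  have hc2 : c ^ 2 = ((v ^ 2 * (r * LinearMap.det (a : (σ → ℝ) →ₗ[ℝ] (σ → ℝ))) : ℝ) : ℂ) := by
    have e : c ^ 2 = c ^ 2 * (vac x ^ 2 * (Sp.follandP (leviSp (dotPairing σ) a d had)).det) := by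
      rw [hxm', mul_one]
    rw [e, ← mul_assoc, ← mul_pow, ← hvc, hdet]
    push_cast
    ring
  have hreal : v ^ 2 * (r * LinearMap.det (a : (σ → ℝ) →ₗ[ℝ] (σ → ℝ))) = 1 := by
    have hn : ‖c ^ 2‖ = 1 := by rw [norm_pow, hc, one_pow]
    rwa [hc2, Complex.norm_real, Real.norm_of_nonneg (mul_nonneg (sq_nonneg _) (mul_nonneg hr.le hdetpos.le))] at hn
  have hc2' : c ^ 2 = 1 := by rw [hc2, hreal, Complex.ofReal_one]
  show vac (levi a d had) ^ 2 * (Sp.follandP (proj (levi a d had))).det = 1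
  rw [proj_levi, hcx, vac_unitScalar_mul, mul_pow, hc2', one_mul]
  exact hxm'

/-- **The general fibre over the Levi (given R1)**: `c · levi a d` is metaplectic iff `c² · sign(det a) = 1` — over
`det a > 0` the metaplectic elements are `± levi a d`, over `det a < 0` they are `± i · levi a d`.
[cite: Folland1989, §4.2 (4.24), Thm. (4.37)] -/
theorem isMetaplectic_unitScalar_mul_levi_iff (h1 : Folland1989_Thm_4_37_ab σ) (c : ℂ) (hc : ‖c‖ = 1)
    (a d : (σ → ℝ) ≃ₗ[ℝ] (σ → ℝ)) (had : ∀ x y, dotPairing σ (a x) (d y) = dotPairing σ x y) :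
    IsMetaplectic (unitScalar c hc * levi a d had) ↔
      c ^ 2 * ((SignType.sign (LinearMap.det (a : (σ → ℝ) →ₗ[ℝ] (σ → ℝ))) : ℝ) : ℂ) = 1 := by
  obtain ⟨v, hv, hvac⟩ := exists_pos_vac_levi a d had
  obtain ⟨r, hr, hdet⟩ := Sp.exists_pos_det_follandP_leviSp a d had
  set s := LinearMap.det (a : (σ → ℝ) →ₗ[ℝ] (σ → ℝ)) with hs
  have hnorm : v ^ 2 * (r * |s|) = 1 := by
    have h := norm_vac_sq_mul_norm_det h1 (levi a d had)
    rwa [proj_levi, hvac, hdet, Complex.norm_real, Complex.norm_real, Real.norm_of_nonneg hv.le, Real.norm_eq_abs,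
      abs_mul, abs_of_pos hr] at h
  have hsign : v ^ 2 * (r * s) = SignType.sign s := by
    conv_lhs => rw [← sign_mul_abs s]
    rw [show v ^ 2 * (r * (↑(SignType.sign s) * |s|)) = ↑(SignType.sign s) * (v ^ 2 * (r * |s|)) by ring, hnorm,
      mul_one]
  rw [isMetaplectic_iff, map_mul, proj_unitScalar, one_mul, proj_levi, vac_unitScalar_mul, hvac, hdet, mul_pow,
    mul_assoc, ← Complex.ofReal_pow, ← Complex.ofReal_mul, hsign]

omit [DecidableEq σ] in
/-- **`levi` is multiplicative**: `levi (a a') (d d') = levi a d · levi a' d'`. [cite: Folland1989, §4.2 (4.24)] -/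
theorem levi_mul (a d a' d' : (σ → ℝ) ≃ₗ[ℝ] (σ → ℝ)) (had : ∀ x y, dotPairing σ (a x) (d y) = dotPairing σ x y)
    (had' : ∀ x y, dotPairing σ (a' x) (d' y) = dotPairing σ x y) :
    levi (a * a') (d * d') (fun x y => by rw [LinearEquiv.mul_apply, LinearEquiv.mul_apply, had, had']) =
      levi a d had * levi a' d' had' :=
  ext' (Subtype.ext (LinearEquiv.ext fun p => by
      simp only [map_mul, proj_levi, Subgroup.coe_mul, LinearEquiv.mul_apply, coe_leviSp_apply]))
    fun f => by
      rw [mul_apply]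
      show leviS (a * a') f = leviS a (leviS a' f)
      rw [leviS_mul, ContinuousLinearMap.comp_apply]

omit [DecidableEq σ] in
/-- `levi 1 1 = 1`. [cite: Folland1989, §4.2 (4.24)] -/
theorem levi_one (h : ∀ x y, dotPairing σ ((1 : (σ → ℝ) ≃ₗ[ℝ] (σ → ℝ)) x) ((1 : (σ → ℝ) ≃ₗ[ℝ] (σ → ℝ)) y) =
    dotPairing σ x y) : levi 1 1 h = 1 :=
  ext' (Subtype.ext (LinearEquiv.ext fun p => by rw [proj_levi, coe_leviSp_apply, map_one]; rfl)) fun f => by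
    show leviS 1 f = f
    rw [leviS_one, ContinuousLinearMap.id_apply]

variable (σ) in
/-- **The Siegel Levi as a group of pairs**: `{(a, d) : a x · d y = x · y}` (so `d = ᵗa⁻¹`), a subgroup of
`GL(ℝ^σ) × GL(ℝ^σ)`. [cite: Folland1989, §4.1 (4.4), §4.2 (4.24)] -/
def leviPairs : Subgroup (((σ → ℝ) ≃ₗ[ℝ] (σ → ℝ)) × ((σ → ℝ) ≃ₗ[ℝ] (σ → ℝ))) where
  carrier := {m | ∀ x y, dotPairing σ (m.1 x) (m.2 y) = dotPairing σ x y}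
  one_mem' := fun _ _ => rfl
  mul_mem' := by
    intro m m' hm hm' x y
    show dotPairing σ (m.1 (m'.1 x)) (m.2 (m'.2 y)) = dotPairing σ x y
    rw [hm, hm']
  inv_mem' := by
    intro m hm x y
    show dotPairing σ (m.1.symm x) (m.2.symm y) = dotPairing σ x y
    conv_rhs => rw [← m.1.apply_symm_apply x, ← m.2.apply_symm_apply y]
    rw [hm]

omit [DecidableEq σ] in
/-- Membership in `leviPairs`. [cite: Folland1989, §4.2 (4.24)] -/
theorem mem_leviPairs_iff (m : ((σ → ℝ) ≃ₗ[ℝ] (σ → ℝ)) × ((σ → ℝ) ≃ₗ[ℝ] (σ → ℝ))) :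
    m ∈ leviPairs σ ↔ ∀ x y, dotPairing σ (m.1 x) (m.2 y) = dotPairing σ x y := Iff.rfl

variable (σ) in
/-- **The geometric section over the Siegel Levi**: `(a, d) ↦ levi a d`, a HOMOMORPHISM `leviPairs σ →* Mp^𝓢(W)`.
[cite: Folland1989, §4.2 (4.24)] -/
def leviHom : leviPairs σ →* MpS σ where
  toFun m := levi m.1.1 m.1.2 m.2
  map_one' := levi_one _
  map_mul' m m' := levi_mul m.1.1 m.1.2 m'.1.1 m'.1.2 m.2 m'.2

omit [DecidableEq σ] in
/-- Unfolding of `leviHom`. [cite: Folland1989, §4.2 (4.24)] -/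
@[simp] theorem leviHom_apply (m : leviPairs σ) : leviHom σ m = levi m.1.1 m.1.2 m.2 := rfl

omit [DecidableEq σ] in
/-- `leviHom m` lies over `m(a, d)`. [cite: Folland1989, §4.2 (4.24)] -/
theorem proj_leviHom (m : leviPairs σ) : proj (leviHom σ m) = leviSp (dotPairing σ) m.1.1 m.1.2 m.2 := rfl

/-- **Given R1, `leviHom m` is metaplectic iff `det a > 0`.** [cite: Folland1989, §4.2 (4.24), Thm. (4.37)] -/
theorem isMetaplectic_leviHom_iff (h1 : Folland1989_Thm_4_37_ab σ) (m : leviPairs σ) :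
    IsMetaplectic (leviHom σ m) ↔ 0 < LinearMap.det (m.1.1 : (σ → ℝ) →ₗ[ℝ] (σ → ℝ)) :=
  isMetaplectic_levi_iff h1 _ _ _

omit [Fintype σ] [DecidableEq σ] in
/-- `det (a a') = det a · det a'` on `GL(ℝ^σ)`. [folklore] -/
private theorem det_mul_aux (a a' : (σ → ℝ) ≃ₗ[ℝ] (σ → ℝ)) :
    LinearMap.det ((a * a' : (σ → ℝ) ≃ₗ[ℝ] (σ → ℝ)) : (σ → ℝ) →ₗ[ℝ] (σ → ℝ)) =
      LinearMap.det (a : (σ → ℝ) →ₗ[ℝ] (σ → ℝ)) * LinearMap.det (a' : (σ → ℝ) →ₗ[ℝ] (σ → ℝ)) := by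
  rw [← LinearMap.det_comp]
  rfl

variable (σ) in
/-- **The positive Levi `GL⁺`**: pairs `(a, ᵗa⁻¹)` with `det a > 0` (the identity component of the Siegel Levi).
[cite: Folland1989, §4.2 (4.24); Kudla1994, §3] -/
def leviPairsPos : Subgroup (((σ → ℝ) ≃ₗ[ℝ] (σ → ℝ)) × ((σ → ℝ) ≃ₗ[ℝ] (σ → ℝ))) where
  carrier := {m | m ∈ leviPairs σ ∧ 0 < LinearMap.det (m.1 : (σ → ℝ) →ₗ[ℝ] (σ → ℝ))}
  one_mem' := ⟨(leviPairs σ).one_mem, by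
    show 0 < LinearMap.det (((1 : (σ → ℝ) ≃ₗ[ℝ] (σ → ℝ))) : (σ → ℝ) →ₗ[ℝ] (σ → ℝ))
    rw [show (((1 : (σ → ℝ) ≃ₗ[ℝ] (σ → ℝ))) : (σ → ℝ) →ₗ[ℝ] (σ → ℝ)) = LinearMap.id from rfl, LinearMap.det_id]
    exact one_pos⟩
  mul_mem' := by
    rintro m m' ⟨hm, hdm⟩ ⟨hm', hdm'⟩
    refine ⟨(leviPairs σ).mul_mem hm hm', ?_⟩
    show 0 < LinearMap.det ((m.1 * m'.1 : (σ → ℝ) ≃ₗ[ℝ] (σ → ℝ)) : (σ → ℝ) →ₗ[ℝ] (σ → ℝ))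
    rw [det_mul_aux]
    exact mul_pos hdm hdm'
  inv_mem' := by
    rintro m ⟨hm, hdm⟩
    refine ⟨(leviPairs σ).inv_mem hm, ?_⟩
    show 0 < LinearMap.det ((m.1⁻¹ : (σ → ℝ) ≃ₗ[ℝ] (σ → ℝ)) : (σ → ℝ) →ₗ[ℝ] (σ → ℝ))
    have h : LinearMap.det ((m.1⁻¹ : (σ → ℝ) ≃ₗ[ℝ] (σ → ℝ)) : (σ → ℝ) →ₗ[ℝ] (σ → ℝ)) *
        LinearMap.det (m.1 : (σ → ℝ) →ₗ[ℝ] (σ → ℝ)) = 1 := by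
      rw [← det_mul_aux, inv_mul_cancel]
      exact LinearMap.det_id
    refine lt_of_not_ge fun hle => ?_
    have h2 := mul_nonpos_iff.2 (Or.inr ⟨hle, hdm.le⟩)
    rw [h] at h2
    exact absurd h2 (not_le.2 one_pos)

omit [DecidableEq σ] in
/-- Membership in the positive Levi. [cite: Folland1989, §4.2 (4.24)] -/
theorem mem_leviPairsPos_iff (m : ((σ → ℝ) ≃ₗ[ℝ] (σ → ℝ)) × ((σ → ℝ) ≃ₗ[ℝ] (σ → ℝ))) :
    m ∈ leviPairsPos σ ↔ m ∈ leviPairs σ ∧ 0 < LinearMap.det (m.1 : (σ → ℝ) →ₗ[ℝ] (σ → ℝ)) := Iff.rfl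

omit [DecidableEq σ] in
/-- `GL⁺ ≤ GL` for the Levi pairs. [cite: Folland1989, §4.2 (4.24)] -/
theorem leviPairsPos_le : leviPairsPos σ ≤ leviPairs σ := fun _ hm => hm.1

variable (σ) in
/-- **The geometric section over the positive Levi**, `GL⁺ →* Mp^𝓢(W)`. [cite: Folland1989, §4.2 (4.24); Kudla1994, §3] -/
def leviHomPos : leviPairsPos σ →* MpS σ := (leviHom σ).comp (Subgroup.inclusion leviPairsPos_le)

omit [DecidableEq σ] in
/-- Unfolding of `leviHomPos`. [cite: Folland1989, §4.2 (4.24)] -/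
theorem leviHomPos_apply (m : leviPairsPos σ) : leviHomPos σ m = levi m.1.1 m.1.2 m.2.1 := rfl

/-- **GIVEN R1, THE METAPLECTIC DOUBLE COVER SPLITS OVER THE POSITIVE SIEGEL LEVI, by the geometric section**:
every `leviHomPos m` is metaplectic, and `leviHomPos` is a homomorphism — the Levi part of Folland's normalised
cocycle is trivial on `GL⁺(n, ℝ)`. [cite: Folland1989, §4.2 (4.24), Thm. (4.37); Kudla1994, §3] -/
theorem isMetaplectic_leviHomPos (h1 : Folland1989_Thm_4_37_ab σ) (m : leviPairsPos σ) :
    IsMetaplectic (leviHomPos σ m) :=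
  (isMetaplectic_levi_iff h1 _ _ _).2 m.2.2

omit [DecidableEq σ] in
/-- `leviHomPos m` lies over `m(a, d)`. [cite: Folland1989, §4.2 (4.24)] -/
theorem proj_leviHomPos (m : leviPairsPos σ) : proj (leviHomPos σ m) = leviSp (dotPairing σ) m.1.1 m.1.2 m.2.1 := rfl


end MpS

end Literature.NumberTheory.Weil1964

end
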